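import Mathlib.AlgebraicGeometry.Morphisms.Flat
import Mathlib.CategoryTheory.Monoidal.Cartesian.Over
import HarnessLib

/-!
# Sections on product-affine opens of `X ×_S T`: the difference along `1_X × k₂` vs `1_X × k₀` is homogeneous ∕ additive
# in the charts of the points `kᵢ : T → X` (the (Mc) N3′ S-e brick J7 of cell hodgecm-mathlib)

Topic `Literature/AlgebraicGeometry/AbelianSchemes`; namespace `Literature.AlgebraicGeometry.AbelianSchemes.Over` (stated for an
arbitrary `X : Over S` — no group structure is used).  THEOREMS ONLY (no definition, no named fact, no instance, no notation, no `sorry`).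

THE PRINT.  [MumfordAV1970] §13, proof of the Theorem (pp. 125–126): along a small extension the liftings of an infinitesimal point
`g` of `X̂` differ by derivations `D`, and the induced change of the pulled-back Poincaré cocycle is computed «on the product
neighbourhoods `Uᵢ × V`» where a section is a sum of products `Σ aᵢ ⊗ bᵢ` — the change is `Σ aᵢ ⊗ D(bᵢ)`, visibly additive and
homogeneous in `D`.  [EGAInew] (EGA I, 2nd ed.) Cor. (1.4.7)-type statement used: for affine `S = Spec R`, `P₁ = Spec A₁ ⊆ X₁`,
`P₂ = Spec A₂ ⊆ X₂`, the open `pr₁⁻¹P₁ ∩ pr₂⁻¹P₂ ⊆ X₁ ×_S X₂` is `Spec (A₁ ⊗_R A₂)` — Mathlib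
`AlgebraicGeometry.isIso_pushoutSection_of_isAffineOpen` ([StacksProject, Tags 01JO–01JS]; [GortzWedhorn2020] Prop. 4.20).

CONTENT (generic plumbing over Mathlib's `pushoutSection` and the cartesian-monoidal `Over S`):
* §1 `prodAffine_sections_induction` — for `S` affine and affine opens `P₁ ⊆ X₁`, `P₂ ⊆ X₂` of `S`-schemes, every section of
  `𝒪_{X₁ ×_S X₂}` over `V = pr₁⁻¹P₁ ∩ pr₂⁻¹P₂` is reached by the induction «`0`, sums, products `pr₁♯(a)|_V · pr₂♯(b)|_V`»
  (Mathlib `isIso_pushoutSection_of_isAffineOpen` + `CommRingCat.isPushout_iff_isPushout` + `Algebra.IsPushout.equiv` +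
  `TensorProduct.induction_on`);
* §2 for ANY `T : Over S` and `T`-points `k : T → X` landing in an affine open `P₂` (`k ⁻¹P₂ = ⊤`), the sections formula
  `appLE_whiskerLeft_left_fst_mul_snd`: `(1 × k)♯ (pr₁♯a · pr₂♯b) = pr₁♯a · pr₂♯(k♯ b)` on `W = pr₁⁻¹P₁ ⊆ X ×_S T` (Mathlib
  `Over.whiskerLeft_left_fst∕snd`, `Scheme.Hom.appLE_comp_appLE`), and the difference form `appLE_whiskerLeft_sub_fst_mul_snd`;
* §3 THE HEADS for any `T`: **`appLE_whiskerLeft_sub_eq_mul_sub_of_sections`** — if `k₂♯ − k₀♯ = μ · (k₁♯ − k₀♯)` on `Γ(X, P₂)`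
  (`μ ∈ Γ(T, 𝒪)`) then for every section `s` over `V`: `(1×k₂)♯ s − (1×k₀)♯ s = pr₂♯(μ) · ((1×k₁)♯ s − (1×k₀)♯ s)` on `W`;
  **`appLE_whiskerLeft_sub_eq_add_sub_of_sections`** — the additive version for four points;
* §4 the CHART form for `T = Spec C′` (ROAD-J7's literal heads): **`appLE_whiskerLeft_sub_eq_mul_sub`** (J7-hom; charts
  `ψᵢ = ΓSpecIso ∘ kᵢ♯ : Γ(X, P₂) → C′`, `ψ₂ − ψ₀ = λ (ψ₁ − ψ₀)`, scalar `pr₂♯(ΓSpecIso⁻¹ λ)`) and **`appLE_whiskerLeft_sub_eq_add_sub`**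
  (J7-add; `ψ₃ − ψ₀ = (ψ₁ − ψ₀) + (ψ₂ − ψ₀)`).  No derivation theory is used (the `ψᵢ` are arbitrary charts).

Cell hodgecm-mathlib (D-0151 ∕ FLOOR 0), P1 (Mc) N3′ S-e, lead B-p07 (g20)'s ROAD-J7 (`F0/P1c/ROAD-J7-DifferenceDerivationLinear`);
consumer: the Kodaira–Spencer count (κ-linearity of `k ↦ [δ_{D_k}]`) through B-p19 (g18)'s (M2′)∕(S3″).  PROOF lane, count-neutral
generic capital.  HC_CM is proved only modulo the 7 printed citations until rung 0 closes; nothing here is about HC.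

## References
* [MumfordAV1970] D. Mumford, *Abelian Varieties* (1970): §13, proof of the Theorem, pp. 125–126 (the computation on `Uᵢ × V`).
* [StacksProject] The Stacks Project, Tags 01JO–01JS (fibre products of schemes; open subschemes and base change; fibre
  products of affines are `Spec` of tensor products) — the forms used by ★ `Morphisms/AffineBaseChangeChart`.
* [GortzWedhorn2020] U. Görtz, T. Wedhorn, *Algebraic Geometry I*, 2nd ed. (2020): Prop. 4.20 (fibre products and open
  subschemes ∕ base change of charts) — the form used by ★ `AbelianSchemes/AbelianSchemeChartBaseChange`.
-/

universe u

open CategoryTheory CategoryTheory.Limits AlgebraicGeometry MonoidalCategory CartesianMonoidalCategory TensorProduct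

noncomputable section

namespace Literature.AlgebraicGeometry.AbelianSchemes.Over

/-! ## §1 Sections over a product of affine opens are generated by products of pulled-back sections -/

/-- **Induction principle for sections over a product-affine open.**  Let `S` be affine, `X₁ X₂ : Over S`, `P₁ ⊆ X₁`, `P₂ ⊆ X₂`
affine opens and `V = pr₁⁻¹P₁ ∩ pr₂⁻¹P₂ ⊆ X₁ ×_S X₂`.  A property of sections of `𝒪` over `V` that holds for `0`, is stable under
`+`, and holds for every product `pr₁♯(a)|_V · pr₂♯(b)|_V` (`a ∈ Γ(X₁, P₁)`, `b ∈ Γ(X₂, P₂)`) holds for every section — because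
`Γ(V) = Γ(P₁) ⊗_{Γ(S)} Γ(P₂)` (Mathlib `isIso_pushoutSection_of_isAffineOpen`). [cite: StacksProject, Tag 01JO]
[cite: GortzWedhorn2020, Prop. 4.20] -/
theorem prodAffine_sections_induction {S : Scheme.{u}} [IsAffine S] (X₁ X₂ : Over S)
    {P₁ : X₁.left.Opens} {P₂ : X₂.left.Opens} (hP₁ : IsAffineOpen P₁) (hP₂ : IsAffineOpen P₂)
    {V : (X₁ ⊗ X₂).left.Opens} (hV : V = (fst X₁ X₂).left ⁻¹ᵁ P₁ ⊓ (snd X₁ X₂).left ⁻¹ᵁ P₂)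
    {motive : Γ((X₁ ⊗ X₂).left, V) → Prop} (zero : motive 0)
    (add : ∀ s t, motive s → motive t → motive (s + t))
    (mul : ∀ (a : Γ(X₁.left, P₁)) (b : Γ(X₂.left, P₂)),
      motive (((fst X₁ X₂).left.appLE P₁ V (hV.trans_le inf_le_left)).hom a *
        ((snd X₁ X₂).left.appLE P₂ V (hV.trans_le inf_le_right)).hom b))
    (s : Γ((X₁ ⊗ X₂).left, V)) : motive s := by
  classical
  have H : IsPullback (fst X₁ X₂).left (snd X₁ X₂).left X₁.hom X₂.hom :=
    IsPullback.of_hasPullback X₁.hom X₂.hom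
  have h1 := isIso_pushoutSection_of_isAffineOpen H (US := ⊤) (UT := P₂) (UX := P₁) le_top le_top
    (UY := V) hV (isAffineOpen_top S) hP₂ hP₁
  have P1 := (isIso_pushoutSection_iff H (US := ⊤) (UT := P₂) (UX := P₁) le_top le_top (UY := V) hV).mp h1
  -- the algebra structures: `R = Γ(S)`, `A = Γ(P₁)`, `B = Γ(P₂)`, `C = Γ(V)`
  letI algA : Algebra Γ(S, ⊤) Γ(X₁.left, P₁) := (X₁.hom.appLE ⊤ P₁ le_top).hom.toAlgebra
  letI algB : Algebra Γ(S, ⊤) Γ(X₂.left, P₂) := (X₂.hom.appLE ⊤ P₂ le_top).hom.toAlgebra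
  letI algAC : Algebra Γ(X₁.left, P₁) Γ((X₁ ⊗ X₂).left, V) :=
    ((fst X₁ X₂).left.appLE P₁ V (hV.trans_le inf_le_left)).hom.toAlgebra
  letI algBC : Algebra Γ(X₂.left, P₂) Γ((X₁ ⊗ X₂).left, V) :=
    ((snd X₁ X₂).left.appLE P₂ V (hV.trans_le inf_le_right)).hom.toAlgebra
  letI algC : Algebra Γ(S, ⊤) Γ((X₁ ⊗ X₂).left, V) :=
    (X₁.hom.appLE ⊤ P₁ le_top ≫ (fst X₁ X₂).left.appLE P₁ V (hV.trans_le inf_le_left)).hom.toAlgebra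
  haveI : IsScalarTower Γ(S, ⊤) Γ(X₁.left, P₁) Γ((X₁ ⊗ X₂).left, V) :=
    IsScalarTower.of_algebraMap_eq fun _ => rfl
  haveI : IsScalarTower Γ(S, ⊤) Γ(X₂.left, P₂) Γ((X₁ ⊗ X₂).left, V) :=
    IsScalarTower.of_algebraMap_eq fun r => by
      change (X₁.hom.appLE ⊤ P₁ le_top ≫ (fst X₁ X₂).left.appLE P₁ V _).hom r =
        ((snd X₁ X₂).left.appLE P₂ V _).hom ((X₂.hom.appLE ⊤ P₂ le_top).hom r)
      rw [P1.w]
      rfl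
  have hP : Algebra.IsPushout Γ(S, ⊤) Γ(X₁.left, P₁) Γ(X₂.left, P₂) Γ((X₁ ⊗ X₂).left, V) :=
    CommRingCat.isPushout_iff_isPushout.mp
      (P1.of_iso (Iso.refl _) (Iso.refl _) (Iso.refl _) (Iso.refl _) rfl rfl rfl rfl)
  let e := Algebra.IsPushout.equiv Γ(S, ⊤) Γ(X₁.left, P₁) Γ(X₂.left, P₂) Γ((X₁ ⊗ X₂).left, V)
  obtain ⟨t, rfl⟩ := e.surjective s
  induction t using TensorProduct.induction_on with
  | zero => rw [map_zero]; exact zero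
  | tmul a b =>
    rw [Algebra.IsPushout.equiv_tmul]
    exact mul a b
  | add x y hx hy => rw [map_add]; exact add _ _ hx hy

/-! ## §2 The sections formula for `1_X × k` on a product of pulled-back sections -/

/-- Congruence of `Scheme.Hom.appLE` in the morphism (private plumbing). [folklore] -/
private theorem appLE_congrHom {X Y : Scheme.{u}} {f g : X ⟶ Y} (e : f = g) (U : Y.Opens) (V : X.Opens)
    (h : V ≤ f ⁻¹ᵁ U) : f.appLE U V h = g.appLE U V (e ▸ h) := by
  subst e; rfl

section Points

variable {S : Scheme.{u}} (X T : Over S)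

/-- For a `T`-point `k : T → X` over `S` landing in the open `P₂` (`k⁻¹P₂ = ⊤`), the open `W = pr₁⁻¹P₁ ⊆ X ×_S T` maps into the
product open `V = pr₁⁻¹P₁ ∩ pr₂⁻¹P₂ ⊆ X ×_S X` under `1_X × k`. [cite: GortzWedhorn2020, Prop. 4.20] [cite: StacksProject, Tag 01JO] -/
theorem le_preimage_whiskerLeft_left (k : T ⟶ X) {P₁ P₂ : X.left.Opens} (hk : k.left ⁻¹ᵁ P₂ = ⊤)
    {V : (X ⊗ X).left.Opens} (hV : V = (fst X X).left ⁻¹ᵁ P₁ ⊓ (snd X X).left ⁻¹ᵁ P₂)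
    {W : (X ⊗ T).left.Opens} (hW : W = (fst X T).left ⁻¹ᵁ P₁) :
    W ≤ (X ◁ k).left ⁻¹ᵁ V := by
  subst hV; subst hW
  have e₁ : (X ◁ k).left ≫ (fst X X).left = (fst X T).left := by
    have e := congrArg Over.Hom.left (CartesianMonoidalCategory.whiskerLeft_fst X k)
    rw [Over.comp_left] at e
    exact e
  have e₂ : (X ◁ k).left ≫ (snd X X).left = (snd X T).left ≫ k.left := by
    have e := congrArg Over.Hom.left (CartesianMonoidalCategory.whiskerLeft_snd X k)
    rw [Over.comp_left, Over.comp_left] at e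
    exact e
  intro x hx
  change (X ◁ k).left x ∈ (fst X X).left ⁻¹ᵁ P₁ ⊓ (snd X X).left ⁻¹ᵁ P₂
  refine ⟨?_, ?_⟩
  · change (fst X X).left ((X ◁ k).left x) ∈ P₁
    rw [← Scheme.Hom.comp_apply, e₁]
    exact hx
  · change (snd X X).left ((X ◁ k).left x) ∈ P₂
    rw [← Scheme.Hom.comp_apply, e₂, Scheme.Hom.comp_apply]
    have : ((snd X T).left x) ∈ k.left ⁻¹ᵁ P₂ := by rw [hk]; trivial
    exact this

/-- **Sections formula for `1_X × k`.**  For a `T`-point `k : T → X` over `S` with `k⁻¹P₂ = ⊤`, `V = pr₁⁻¹P₁ ∩ pr₂⁻¹P₂ ⊆ X ×_S X`,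
`W = pr₁⁻¹P₁ ⊆ X ×_S T`, and sections `a ∈ Γ(X, P₁)`, `b ∈ Γ(X, P₂)`:
`(1 × k)♯ (pr₁♯a · pr₂♯b)|_W = pr₁♯a|_W · pr₂♯(k♯ b)|_W`, where `k♯ b ∈ Γ(T, ⊤)` — because `(1 × k) ≫ pr₁ = pr₁` and
`(1 × k) ≫ pr₂ = pr₂ ≫ k` (Mathlib `Over.whiskerLeft_left_fst∕snd`). [cite: MumfordAV1970, §13 (proof of the Thm. pp. 125–126)] -/
theorem appLE_whiskerLeft_left_fst_mul_snd (k : T ⟶ X) {P₁ P₂ : X.left.Opens} (hk : k.left ⁻¹ᵁ P₂ = ⊤)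
    {V : (X ⊗ X).left.Opens} (hV : V = (fst X X).left ⁻¹ᵁ P₁ ⊓ (snd X X).left ⁻¹ᵁ P₂)
    {W : (X ⊗ T).left.Opens} (hW : W = (fst X T).left ⁻¹ᵁ P₁)
    (h : W ≤ (X ◁ k).left ⁻¹ᵁ V) (a : Γ(X.left, P₁)) (b : Γ(X.left, P₂)) :
    ((X ◁ k).left.appLE V W h).hom
        (((fst X X).left.appLE P₁ V (hV.trans_le inf_le_left)).hom a *
          ((snd X X).left.appLE P₂ V (hV.trans_le inf_le_right)).hom b) =
      ((fst X T).left.appLE P₁ W hW.le).hom a *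
        ((snd X T).left.appLE ⊤ W le_top).hom ((k.left.appLE P₂ ⊤ hk.ge).hom b) := by
  rw [map_mul]
  congr 1
  · rw [← CommRingCat.comp_apply, Scheme.Hom.appLE_comp_appLE]
    exact congrArg (fun φ => (CommRingCat.Hom.hom φ) a)
      (appLE_congrHom (f := (X ◁ k).left ≫ (fst X X).left) (g := (fst X T).left)
        (by rw [Over.fst_left, Over.fst_left]; exact Over.whiskerLeft_left_fst k) P₁ W _)
  · rw [← CommRingCat.comp_apply, ← CommRingCat.comp_apply, Scheme.Hom.appLE_comp_appLE,
      Scheme.Hom.appLE_comp_appLE]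
    exact congrArg (fun φ => (CommRingCat.Hom.hom φ) b)
      (appLE_congrHom (f := (X ◁ k).left ≫ (snd X X).left) (g := (snd X T).left ≫ k.left)
        (by rw [Over.snd_left, Over.snd_left]; exact Over.whiskerLeft_left_snd k) P₂ W _)

/-- The difference of two such pull-backs on a product of sections:
`(1×k)♯(pr₁♯a · pr₂♯b) − (1×k₀)♯(pr₁♯a · pr₂♯b) = pr₁♯a · pr₂♯(k♯b − k₀♯b)`. [cite: MumfordAV1970, §13 (proof of the Thm. pp. 125–126)] -/
theorem appLE_whiskerLeft_sub_fst_mul_snd (k₀ k : T ⟶ X) {P₁ P₂ : X.left.Opens}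
    (hk₀ : k₀.left ⁻¹ᵁ P₂ = ⊤) (hk : k.left ⁻¹ᵁ P₂ = ⊤)
    {V : (X ⊗ X).left.Opens} (hV : V = (fst X X).left ⁻¹ᵁ P₁ ⊓ (snd X X).left ⁻¹ᵁ P₂)
    {W : (X ⊗ T).left.Opens} (hW : W = (fst X T).left ⁻¹ᵁ P₁)
    (h₀ : W ≤ (X ◁ k₀).left ⁻¹ᵁ V) (h : W ≤ (X ◁ k).left ⁻¹ᵁ V) (a : Γ(X.left, P₁)) (b : Γ(X.left, P₂)) :
    ((X ◁ k).left.appLE V W h).hom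
        (((fst X X).left.appLE P₁ V (hV.trans_le inf_le_left)).hom a *
          ((snd X X).left.appLE P₂ V (hV.trans_le inf_le_right)).hom b) -
      ((X ◁ k₀).left.appLE V W h₀).hom
        (((fst X X).left.appLE P₁ V (hV.trans_le inf_le_left)).hom a *
          ((snd X X).left.appLE P₂ V (hV.trans_le inf_le_right)).hom b) =
      ((fst X T).left.appLE P₁ W hW.le).hom a *
        ((snd X T).left.appLE ⊤ W le_top).hom
          ((k.left.appLE P₂ ⊤ hk.ge).hom b - (k₀.left.appLE P₂ ⊤ hk₀.ge).hom b) := by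
  rw [appLE_whiskerLeft_left_fst_mul_snd X T k hk hV hW h a b,
    appLE_whiskerLeft_left_fst_mul_snd X T k₀ hk₀ hV hW h₀ a b, map_sub, mul_sub]

end Points

/-! ## §3 The heads: homogeneity and additivity of the difference in the charts -/

section Heads

variable {S : Scheme.{u}} [IsAffine S] (X T : Over S)

/-- **The difference along `1 × k₂` vs `1 × k₀` is `pr₂♯(μ)` times the one along `1 × k₁` vs `1 × k₀`, when the sections charts
satisfy `k₂♯ − k₀♯ = μ (k₁♯ − k₀♯)`** — `T`-points `kᵢ : T → X` over the affine `S` (`i = 0, 1, 2`) landing in the affine open `P₂`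
(`kᵢ⁻¹P₂ = ⊤`), a scalar `μ ∈ Γ(T, 𝒪_T)` with `k₂♯ g − k₀♯ g = μ (k₁♯ g − k₀♯ g)` for all `g ∈ Γ(X, P₂)`; `P₁ ⊆ X` affine,
`V = pr₁⁻¹P₁ ∩ pr₂⁻¹P₂ ⊆ X ×_S X`, `W = pr₁⁻¹P₁ ⊆ X ×_S T`.  Then for every `s ∈ Γ(X ×_S X, V)`:
`(1×k₂)♯ s|_W − (1×k₀)♯ s|_W = pr₂♯(μ)|_W · ((1×k₁)♯ s|_W − (1×k₀)♯ s|_W)`.  Proof: both sides are additive in `s`, `Γ(V)` is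
generated by products `pr₁♯a · pr₂♯b` (§1), on which it is `pr₁♯a · pr₂♯(k₂♯b − k₀♯b) = pr₂♯μ · pr₁♯a · pr₂♯(k₁♯b − k₀♯b)` (§2).
[MumfordAV1970] §13 p. 126: the change of the cocycle on `Uᵢ × V` is `Σ aᵢ ⊗ D bᵢ`, linear in `D`.
[cite: MumfordAV1970, §13 (proof of the Thm. pp. 125–126)] [cite: StacksProject, Tag 01JO] -/
theorem appLE_whiskerLeft_sub_eq_mul_sub_of_sections (k₀ k₁ k₂ : T ⟶ X) {P₁ P₂ : X.left.Opens}
    (hP₁ : IsAffineOpen P₁) (hP₂ : IsAffineOpen P₂)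
    (hk₀ : k₀.left ⁻¹ᵁ P₂ = ⊤) (hk₁ : k₁.left ⁻¹ᵁ P₂ = ⊤) (hk₂ : k₂.left ⁻¹ᵁ P₂ = ⊤) (μ : Γ(T.left, ⊤))
    (hψ : ∀ g : Γ(X.left, P₂),
      (k₂.left.appLE P₂ ⊤ hk₂.ge).hom g - (k₀.left.appLE P₂ ⊤ hk₀.ge).hom g =
        μ * ((k₁.left.appLE P₂ ⊤ hk₁.ge).hom g - (k₀.left.appLE P₂ ⊤ hk₀.ge).hom g))
    {V : (X ⊗ X).left.Opens} (hV : V = (fst X X).left ⁻¹ᵁ P₁ ⊓ (snd X X).left ⁻¹ᵁ P₂)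
    {W : (X ⊗ T).left.Opens} (hW : W = (fst X T).left ⁻¹ᵁ P₁)
    (h₀ : W ≤ (X ◁ k₀).left ⁻¹ᵁ V) (h₁ : W ≤ (X ◁ k₁).left ⁻¹ᵁ V) (h₂ : W ≤ (X ◁ k₂).left ⁻¹ᵁ V)
    (s : Γ((X ⊗ X).left, V)) :
    ((X ◁ k₂).left.appLE V W h₂).hom s - ((X ◁ k₀).left.appLE V W h₀).hom s =
      ((snd X T).left.appLE ⊤ W le_top).hom μ *
        (((X ◁ k₁).left.appLE V W h₁).hom s - ((X ◁ k₀).left.appLE V W h₀).hom s) := by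
  induction s using prodAffine_sections_induction X X hP₁ hP₂ hV with
  | zero => simp only [map_zero, sub_zero, mul_zero]
  | add s t hs ht =>
    simp only [map_add] at hs ht ⊢
    rw [add_sub_add_comm, hs, ht, add_sub_add_comm, mul_add]
  | mul a b =>
    rw [appLE_whiskerLeft_sub_fst_mul_snd X T k₀ k₂ hk₀ hk₂ hV hW h₀ h₂ a b,
      appLE_whiskerLeft_sub_fst_mul_snd X T k₀ k₁ hk₀ hk₁ hV hW h₀ h₁ a b, hψ b, map_mul, mul_left_comm]

/-- **The difference along `1 × k₃` vs `1 × k₀` is the SUM of those along `1 × k₁` and `1 × k₂`, when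
`k₃♯ − k₀♯ = (k₁♯ − k₀♯) + (k₂♯ − k₀♯)`** (same setting as `appLE_whiskerLeft_sub_eq_mul_sub_of_sections`, four `T`-points).
[cite: MumfordAV1970, §13 (proof of the Thm. pp. 125–126)] [cite: StacksProject, Tag 01JO] -/
theorem appLE_whiskerLeft_sub_eq_add_sub_of_sections (k₀ k₁ k₂ k₃ : T ⟶ X) {P₁ P₂ : X.left.Opens}
    (hP₁ : IsAffineOpen P₁) (hP₂ : IsAffineOpen P₂)
    (hk₀ : k₀.left ⁻¹ᵁ P₂ = ⊤) (hk₁ : k₁.left ⁻¹ᵁ P₂ = ⊤) (hk₂ : k₂.left ⁻¹ᵁ P₂ = ⊤) (hk₃ : k₃.left ⁻¹ᵁ P₂ = ⊤)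
    (hψ : ∀ g : Γ(X.left, P₂),
      (k₃.left.appLE P₂ ⊤ hk₃.ge).hom g - (k₀.left.appLE P₂ ⊤ hk₀.ge).hom g =
        ((k₁.left.appLE P₂ ⊤ hk₁.ge).hom g - (k₀.left.appLE P₂ ⊤ hk₀.ge).hom g) +
          ((k₂.left.appLE P₂ ⊤ hk₂.ge).hom g - (k₀.left.appLE P₂ ⊤ hk₀.ge).hom g))
    {V : (X ⊗ X).left.Opens} (hV : V = (fst X X).left ⁻¹ᵁ P₁ ⊓ (snd X X).left ⁻¹ᵁ P₂)
    {W : (X ⊗ T).left.Opens} (hW : W = (fst X T).left ⁻¹ᵁ P₁)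
    (h₀ : W ≤ (X ◁ k₀).left ⁻¹ᵁ V) (h₁ : W ≤ (X ◁ k₁).left ⁻¹ᵁ V) (h₂ : W ≤ (X ◁ k₂).left ⁻¹ᵁ V)
    (h₃ : W ≤ (X ◁ k₃).left ⁻¹ᵁ V) (s : Γ((X ⊗ X).left, V)) :
    ((X ◁ k₃).left.appLE V W h₃).hom s - ((X ◁ k₀).left.appLE V W h₀).hom s =
      (((X ◁ k₁).left.appLE V W h₁).hom s - ((X ◁ k₀).left.appLE V W h₀).hom s) +
        (((X ◁ k₂).left.appLE V W h₂).hom s - ((X ◁ k₀).left.appLE V W h₀).hom s) := by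
  induction s using prodAffine_sections_induction X X hP₁ hP₂ hV with
  | zero => simp only [map_zero, sub_zero, add_zero]
  | add s t hs ht =>
    simp only [map_add] at hs ht ⊢
    rw [add_sub_add_comm, hs, ht]
    abel
  | mul a b =>
    rw [appLE_whiskerLeft_sub_fst_mul_snd X T k₀ k₃ hk₀ hk₃ hV hW h₀ h₃ a b,
      appLE_whiskerLeft_sub_fst_mul_snd X T k₀ k₁ hk₀ hk₁ hV hW h₀ h₁ a b,
      appLE_whiskerLeft_sub_fst_mul_snd X T k₀ k₂ hk₀ hk₂ hV hW h₀ h₂ a b, hψ b, map_add, mul_add]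

end Heads

/-! ## §4 The heads in chart form (`T = Spec C′`, charts `ψᵢ = ΓSpecIso ∘ kᵢ♯ : Γ(X, P₂) → C′`): (J7-hom) and (J7-add) -/

/-- Transport of the chart relation through `Γ(Spec C′, ⊤) ≅ C′`: `ΓSpecIso⁻¹ (ΓSpecIso y) = y`. [folklore] -/
private theorem ΓSpecIso_inv_hom_apply {S : Scheme.{u}} {C' : Type u} [CommRing C'] (c' : Spec (.of C') ⟶ S)
    (y : Γ((Over.mk c').left, ⊤)) :
    (Scheme.ΓSpecIso (.of C')).inv.hom
      (CommRingCat.Hom.hom (R := Γ((Over.mk c').left, ⊤)) (Scheme.ΓSpecIso (.of C')).hom y) = y :=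
  congrArg (fun φ : Γ(Spec (.of C'), ⊤) ⟶ Γ(Spec (.of C'), ⊤) => φ.hom y) (Scheme.ΓSpecIso (.of C')).hom_inv_id

section Charts

variable {S : Scheme.{u}} [IsAffine S] (X : Over S) {C' : Type u} [CommRing C'] (c' : Spec (.of C') ⟶ S)

/-- **(J7-hom)** — `appLE_whiskerLeft_sub_eq_mul_sub_of_sections` for `T = Spec C′` with the charts `ψᵢ := ΓSpecIso ∘ kᵢ♯ :
Γ(X, P₂) → C′` and a scalar `λ ∈ C′`: if `ψ₂ g − ψ₀ g = λ (ψ₁ g − ψ₀ g)` for all `g`, then for every `s ∈ Γ(X ×_S X, V)`: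
`(1×k₂)♯ s|_W − (1×k₀)♯ s|_W = pr₂♯(ΓSpecIso⁻¹ λ)|_W · ((1×k₁)♯ s|_W − (1×k₀)♯ s|_W)` (the shape of ROAD-J7, consumed by the
Kodaira–Spencer count of the (Mc) N3′ line). [cite: MumfordAV1970, §13 (proof of the Thm. pp. 125–126)] [cite: StacksProject, Tag 01JO] -/
theorem appLE_whiskerLeft_sub_eq_mul_sub (k₀ k₁ k₂ : Over.mk c' ⟶ X) {P₁ P₂ : X.left.Opens}
    (hP₁ : IsAffineOpen P₁) (hP₂ : IsAffineOpen P₂)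
    (hk₀ : k₀.left ⁻¹ᵁ P₂ = ⊤) (hk₁ : k₁.left ⁻¹ᵁ P₂ = ⊤) (hk₂ : k₂.left ⁻¹ᵁ P₂ = ⊤) (lam : C')
    (hψ : ∀ g : Γ(X.left, P₂),
      (k₂.left.appLE P₂ ⊤ hk₂.ge ≫ (Scheme.ΓSpecIso (.of C')).hom).hom g -
          (k₀.left.appLE P₂ ⊤ hk₀.ge ≫ (Scheme.ΓSpecIso (.of C')).hom).hom g =
        lam * ((k₁.left.appLE P₂ ⊤ hk₁.ge ≫ (Scheme.ΓSpecIso (.of C')).hom).hom g -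
          (k₀.left.appLE P₂ ⊤ hk₀.ge ≫ (Scheme.ΓSpecIso (.of C')).hom).hom g))
    {V : (X ⊗ X).left.Opens} (hV : V = (fst X X).left ⁻¹ᵁ P₁ ⊓ (snd X X).left ⁻¹ᵁ P₂)
    {W : (X ⊗ Over.mk c').left.Opens} (hW : W = (fst X (Over.mk c')).left ⁻¹ᵁ P₁)
    (h₀ : W ≤ (X ◁ k₀).left ⁻¹ᵁ V) (h₁ : W ≤ (X ◁ k₁).left ⁻¹ᵁ V) (h₂ : W ≤ (X ◁ k₂).left ⁻¹ᵁ V)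
    (s : Γ((X ⊗ X).left, V)) :
    ((X ◁ k₂).left.appLE V W h₂).hom s - ((X ◁ k₀).left.appLE V W h₀).hom s =
      ((snd X (Over.mk c')).left.appLE ⊤ W le_top).hom ((Scheme.ΓSpecIso (.of C')).inv.hom lam) *
        (((X ◁ k₁).left.appLE V W h₁).hom s - ((X ◁ k₀).left.appLE V W h₀).hom s) := by
  refine appLE_whiskerLeft_sub_eq_mul_sub_of_sections X (Over.mk c') k₀ k₁ k₂ hP₁ hP₂ hk₀ hk₁ hk₂
    (show Γ((Over.mk c').left, ⊤) from (Scheme.ΓSpecIso (.of C')).inv.hom lam) (fun g => ?_) hV hW h₀ h₁ h₂ s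
  have e := congrArg (Scheme.ΓSpecIso (.of C')).inv.hom (hψ g)
  simp only [map_sub, map_mul, CommRingCat.hom_comp, RingHom.comp_apply] at e
  rw [ΓSpecIso_inv_hom_apply c' ((k₂.left.appLE P₂ ⊤ hk₂.ge).hom g),
    ΓSpecIso_inv_hom_apply c' ((k₁.left.appLE P₂ ⊤ hk₁.ge).hom g),
    ΓSpecIso_inv_hom_apply c' ((k₀.left.appLE P₂ ⊤ hk₀.ge).hom g)] at e
  exact e

/-- **(J7-add)** — `appLE_whiskerLeft_sub_eq_add_sub_of_sections` for `T = Spec C′` in chart form: if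
`ψ₃ g − ψ₀ g = (ψ₁ g − ψ₀ g) + (ψ₂ g − ψ₀ g)` for all `g`, then `(1×k₃)♯ s − (1×k₀)♯ s = ((1×k₁)♯ s − (1×k₀)♯ s) + ((1×k₂)♯ s − (1×k₀)♯ s)`
on `W`. [cite: MumfordAV1970, §13 (proof of the Thm. pp. 125–126)] [cite: StacksProject, Tag 01JO] -/
theorem appLE_whiskerLeft_sub_eq_add_sub (k₀ k₁ k₂ k₃ : Over.mk c' ⟶ X) {P₁ P₂ : X.left.Opens}
    (hP₁ : IsAffineOpen P₁) (hP₂ : IsAffineOpen P₂)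
    (hk₀ : k₀.left ⁻¹ᵁ P₂ = ⊤) (hk₁ : k₁.left ⁻¹ᵁ P₂ = ⊤) (hk₂ : k₂.left ⁻¹ᵁ P₂ = ⊤) (hk₃ : k₃.left ⁻¹ᵁ P₂ = ⊤)
    (hψ : ∀ g : Γ(X.left, P₂),
      (k₃.left.appLE P₂ ⊤ hk₃.ge ≫ (Scheme.ΓSpecIso (.of C')).hom).hom g -
          (k₀.left.appLE P₂ ⊤ hk₀.ge ≫ (Scheme.ΓSpecIso (.of C')).hom).hom g =
        ((k₁.left.appLE P₂ ⊤ hk₁.ge ≫ (Scheme.ΓSpecIso (.of C')).hom).hom g -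
            (k₀.left.appLE P₂ ⊤ hk₀.ge ≫ (Scheme.ΓSpecIso (.of C')).hom).hom g) +
          ((k₂.left.appLE P₂ ⊤ hk₂.ge ≫ (Scheme.ΓSpecIso (.of C')).hom).hom g -
            (k₀.left.appLE P₂ ⊤ hk₀.ge ≫ (Scheme.ΓSpecIso (.of C')).hom).hom g))
    {V : (X ⊗ X).left.Opens} (hV : V = (fst X X).left ⁻¹ᵁ P₁ ⊓ (snd X X).left ⁻¹ᵁ P₂)
    {W : (X ⊗ Over.mk c').left.Opens} (hW : W = (fst X (Over.mk c')).left ⁻¹ᵁ P₁)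
    (h₀ : W ≤ (X ◁ k₀).left ⁻¹ᵁ V) (h₁ : W ≤ (X ◁ k₁).left ⁻¹ᵁ V) (h₂ : W ≤ (X ◁ k₂).left ⁻¹ᵁ V)
    (h₃ : W ≤ (X ◁ k₃).left ⁻¹ᵁ V) (s : Γ((X ⊗ X).left, V)) :
    ((X ◁ k₃).left.appLE V W h₃).hom s - ((X ◁ k₀).left.appLE V W h₀).hom s =
      (((X ◁ k₁).left.appLE V W h₁).hom s - ((X ◁ k₀).left.appLE V W h₀).hom s) +
        (((X ◁ k₂).left.appLE V W h₂).hom s - ((X ◁ k₀).left.appLE V W h₀).hom s) := by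
  refine appLE_whiskerLeft_sub_eq_add_sub_of_sections X (Over.mk c') k₀ k₁ k₂ k₃ hP₁ hP₂ hk₀ hk₁ hk₂ hk₃
    (fun g => ?_) hV hW h₀ h₁ h₂ h₃ s
  have e := congrArg (Scheme.ΓSpecIso (.of C')).inv.hom (hψ g)
  simp only [map_sub, map_add, CommRingCat.hom_comp, RingHom.comp_apply] at e
  rw [ΓSpecIso_inv_hom_apply c' ((k₃.left.appLE P₂ ⊤ hk₃.ge).hom g),
    ΓSpecIso_inv_hom_apply c' ((k₂.left.appLE P₂ ⊤ hk₂.ge).hom g),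
    ΓSpecIso_inv_hom_apply c' ((k₁.left.appLE P₂ ⊤ hk₁.ge).hom g),
    ΓSpecIso_inv_hom_apply c' ((k₀.left.appLE P₂ ⊤ hk₀.ge).hom g)] at e
  exact e

end Charts

end Literature.AlgebraicGeometry.AbelianSchemes.Over

end
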